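import Summits.AtomisticToContinuum.BoseEinsteinCondensation.Theorems.BECCutLineWeakDisorderTwoReplicaTransienceBoundBeyondIff
import Summits.AtomisticToContinuum.BoseEinsteinCondensation.Theorems.BECCutLineWeakDisorderTwoReplicaTransienceBoundKineticWindow
import HarnessLib

/-!
# Crux `TwoReplicaTransienceBound` (stmt-AtomisticToContinuum-9687) — CHECKED SKELETON v7.1 of the line
# `SketchIdeator1` (tracer decoupling), lead prover's work file (continuation c4): MEAN-FREE-TIME RESHAPE, all windows landed

v7 (this seat, registered 21:05Z) reshaped the time axis by the mean-free time; v7.1 is v7 with every provable stub LANDED and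
imported (proposals: `stub_sliceMoment` p125654, `stub_slicedDomination` p125758, `stub_slicedPenaltyMeasurable` +
`stub_slicedPenaltyIntegral` p125803, `stub_sliceMomentCubic` p126305, `stub_slicedInsertionStep` + `stub_meanFreeWindow` p126019,
`stub_kineticWindow` …KineticWindow.lean, `twoReplicaTransienceBound_iff_beyondMeanFreeTime` + `shortWindow_of_meanFreeWindow`
…BeyondIff.lean). What the tree now KNOWS (kernel-checked), for EVERY admissible pair potential `v` (hard cores included):

* MEAN-FREE WINDOW `stub_meanFreeWindow`: `∃ κ(R) > 0, ∃ ρ₁(R) > 0, ∀ ρ < ρ₁, ∀ᶠ n, ∀ T ∈ [0, κ/ρ]: ∫ L³ m_T²/s_T² ≤ 20`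
  (contains c3's short window `∀T₀ ∃ρ₁(T₀)`, `shortWindow_of_meanFreeWindow`);
* KINETIC WINDOW `stub_kineticWindow` (scale-covariant): range `R > 0`, `ρR³ ≤ 10⁻⁹`, `∀ᶠ n`, `∀ T` with `ρRT ≤ 10⁻⁹`: `≤ 20`;
* `twoReplicaTransienceBound_iff_beyondMeanFreeTime`: the crux ⟺ the ONE open stub below.

OPEN (crux-sized): `stub_beyondMeanFreeTime` — the crux from the polymer length `κ/ρ` on (for every `κ > 0`; used at `κ = κ(R)`).
Beyond the kinetic time inserting the tagged line costs `e^{-μT}` (`μ ≍ ρa`), the recursion's own conclusion `Θ N_n ≤ 2N_{n+1}` is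
false, and only the genuine two-replica (Lyapunov-exponent) identity can work: LeadC4Report.md §6 and the crux idea card
Ideas/newtonian-variance-two-replica-window.md type the two missing inputs (FK superstability for the window up to `c/(ρ²‖v‖₁⁴)`;
hyperuniform slices, `S(k) → 0`, i.e. BEC-strength, for all `T`).

Composition: `twoReplicaTransienceBound_iff_beyondMeanFreeTime.2 stub_beyondMeanFreeTime` (sorry-free, by name).
-/

noncomputable section

namespace Summit.AtomisticToContinuum.BoseEinsteinCondensation.Cruxes.TwoReplicaTransienceBound.TracerDecoupling

open MeasureTheory Filter Set
open scoped ENNReal NNReal Topology BigOperators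
open Literature.MathematicalPhysics.QuantumManyBody.BoseGas

/-! ### The one registered open stub (v7.1) -/

/-- STUB (OPEN; crux-sized): **the crux beyond the mean-free time** — for every `κ > 0`, the bound from the polymer length `κ/ρ`
on; EQUIVALENT to the crux (`twoReplicaTransienceBound_iff_beyondMeanFreeTime`, landed). -/
theorem stub_beyondMeanFreeTime :
    ∀ (v : ℝ → ENNReal), IsRepulsiveFiniteRange v → ∀ κ : ℝ, 0 < κ → ∃ ρ₀ : ℝ, 0 < ρ₀ ∧
      ∀ ρ : ℝ, 0 < ρ → ρ < ρ₀ → ∃ C : ℝ, 0 < C ∧ ∀ᶠ n : ℕ in Filter.atTop, ∀ T : ℝ, κ / ρ ≤ T →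
        ∫⁻ Y : Config n, ENNReal.ofReal (sideLength ρ (n + 1) ^ 3) *
            (∫⁻ x, (‖@fkWitness (n + 1) v (sideLength ρ (n + 1)) T (fun _ => (1 : ENNReal))
              (Matrix.vecCons x Y)‖₊ : ENNReal) ^ 2) ^ 2 /
            (∫⁻ x, (‖@fkWitness (n + 1) v (sideLength ρ (n + 1)) T (fun _ => (1 : ENNReal))
              (Matrix.vecCons x Y)‖₊ : ENNReal)) ^ 2 ≤ ENNReal.ofReal C := by
  sorry

/-! ### The composition (sorry-free): the landed iff, backward direction -/

/-- The crux from the one open stub (what the closing file will say once `stub_beyondMeanFreeTime` is a theorem):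
`TwoReplicaTransienceBound` BY NAME, via the landed `twoReplicaTransienceBound_iff_beyondMeanFreeTime` (whose backward
direction is the composition of the landed mean-free window `stub_meanFreeWindow` with the open stub at `κ = κ(R)`). -/
theorem twoReplicaTransienceBound_proof_skeleton :
    Summit.AtomisticToContinuum.BoseEinsteinCondensation.Theses.BECCutLineWeakDisorder.TwoReplicaTransienceBound :=
  twoReplicaTransienceBound_iff_beyondMeanFreeTime.2 stub_beyondMeanFreeTime

end Summit.AtomisticToContinuum.BoseEinsteinCondensation.Cruxes.TwoReplicaTransienceBound.TracerDecoupling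

end
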